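import Literature.Topology.FourManifolds.EmbeddedSubmanifoldNormalArc
import Literature.Geometry.Manifold.ModelChange
import HarnessLib

/-!
# Closing an arc to an embedded circle, and dual circles to embedded submanifolds, for an
# arbitrary boundaryless model; the dual circle of a non-separating `n`-sphere in `S¹ × Sⁿ`
# (Budney–Gabai Thm. 3.13)

Sequel to `Literature/Topology/FourManifolds/EmbeddedSubmanifoldNormalArc.lean` (normal arcs
through a point of a compact embedded submanifold of positive codimension, for arbitrary
boundaryless finite-dimensional real models; dual circles when the ambient manifold is charted
on `ℝᵐ`).  Here the ambient compact manifold `N` may carry an **arbitrary boundaryless model**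
`(G, J)`: `N` is re-charted on `ℝᵐ`, `m = dim N`, along `J` followed by a linear isomorphism
`E' ≃L ℝᵐ`, by the tree's change-of-model synonym `Literature.Geometry.Manifold.Rechart`
(`ModelChange.lean`: the identity maps `into`, `out` are `C^∞` in both directions); arcs are
pushed forward, closed up there by `Milnor1965_exists_embedding_circle_through_arc_holds`
(Milnor 1965, proof of Lemma 8.3 with Whitney's Lemma 6.12), and the circles are pulled back.

* `exists_normalArc_subset` — the normal arc of `exists_normalArc_of_isSmoothEmbedding` may be
  taken inside any prescribed neighbourhood of its midpoint (restrict and reparametrise by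
  `arctan`).
* `exists_circle_through_arc` — **closing an arc** in a compact manifold of dimension `m ≥ 3`
  over any boundaryless model: an injective immersion `γ : ℝ → N` whose points `γ t`, `t ≠ 0`,
  lie in a connected open set `O` closes up to a smoothly embedded circle through `γ 0`, with all
  other points in `O`, equal to `γ [-1, 1]` near `γ 0`.
* `EmbeddedSubmanifold.exists_dualCircle` — **dual circles**: for a `C^∞` embedding `f : M → N`
  of a compact manifold of smaller dimension with connected complement, through every `f x₀`
  there is a smoothly embedded circle meeting `f(M)` exactly in one point, equal near it to a
  normal arc `γ` (`γ'(0) ∉ df_{x₀}(T_{x₀}M)`), i.e. crossing `f(M)` once, transversally.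

The case that motivates it is the first step of the proof of Budney–Gabai, *Knotted 3-balls in
`S⁴`* (arXiv:1912.09029), Thm. 3.13 (p. 22): *"observe that complementary to a non-separating
sphere there is an embedding `S¹ → S¹ × Sⁿ` that intersects the sphere precisely once and
transversely"* — `S¹ × Sⁿ` comes charted on `ℝ¹ × ℝⁿ` with the product model
`(𝓡 1).prod (𝓡 n)`, not on `ℝⁿ⁺¹`:

* `BudneyGabai2019_thm_3_13.exists_dualCircle` — for a smoothly embedded `n`-sphere
  `e : Sⁿ → S¹ × Sⁿ`, `n ≥ 2`, with connected complement and any `x₀ ∈ Sⁿ`, there is a smoothly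
  embedded circle `c : S¹ → S¹ × Sⁿ` meeting `e(Sⁿ)` exactly in the point `c s₀ = e x₀`, equal
  near that point to a normal arc `γ` (`γ 0 = e x₀`, `γ` meets `e(Sⁿ)` only at `0`,
  `γ'(0) ∉ de_{x₀}(T Sⁿ)`).

Everything here is proved; no definition and no named fact is introduced.

## References

* R. Budney, D. Gabai, *Knotted 3-balls in `S⁴`*, arXiv:1912.09029 (v2), §3, proof of Thm. 3.13
  (p. 22). [BudneyGabai2019]
* J. Milnor, *Lectures on the h-cobordism theorem*, Princeton (1965), proof of Lemma 8.3 (PDF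
  p. 56), Lemma 6.12. [MilnorHCobordism1965]
* J. M. Lee, *Introduction to Smooth Manifolds*, 2nd ed. (2013), Prop. 1.17 (compatible atlases),
  Thm. 5.8 (slice charts). [LeeSmoothManifolds2013]
-/

noncomputable section

open scoped Manifold ContDiff Topology Real
open Set Function Metric Module
open Literature.Geometry.Manifold

namespace Literature.Topology.FourManifolds

universe u v

section General

variable {E H : Type*} [NormedAddCommGroup E] [NormedSpace ℝ E] [TopologicalSpace H]
  {E' : Type u} {G : Type*} [NormedAddCommGroup E'] [NormedSpace ℝ E'] [TopologicalSpace G]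
  {I : ModelWithCorners ℝ E H} {J : ModelWithCorners ℝ E' G}
  {M : Type*} [TopologicalSpace M] [ChartedSpace H M]
  {N : Type v} [TopologicalSpace N] [ChartedSpace G N]

/-! ### Restricting an arc to a neighbourhood of its midpoint -/

/-- The reparametrisation `s ↦ (2δ/π) arctan s` of `ℝ` onto `(-δ, δ)`: smooth, injective,
vanishing at `0`, with image in `(-δ, δ)` and nowhere-vanishing derivative. [folklore] -/
private theorem arctan_reparam' {δ : ℝ} (hδ : 0 < δ) :
    ∃ σ : ℝ → ℝ, ContDiff ℝ ∞ σ ∧ Injective σ ∧ σ 0 = 0 ∧ (∀ s, |σ s| < δ) ∧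
      ∃ σ' : ℝ → ℝ, (∀ s, HasDerivAt σ (σ' s) s) ∧ ∀ s, σ' s ≠ 0 := by
  refine ⟨fun s ↦ δ * (2 / π) * Real.arctan s, contDiff_const.mul Real.contDiff_arctan, ?_, ?_,
    ?_, fun s ↦ δ * (2 / π) * (1 / (1 + s ^ 2)), fun s ↦ (Real.hasDerivAt_arctan s).const_mul _,
    fun s ↦ ?_⟩
  · have hc : 0 < δ * (2 / π) := by positivity
    exact (Real.arctan_strictMono.const_mul hc).injective
  · simp
  · intro s
    have h1 := Real.arctan_lt_pi_div_two s
    have h2 := Real.neg_pi_div_two_lt_arctan s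
    have hπ := Real.pi_pos
    rw [abs_lt]
    constructor
    · have : δ * (2 / π) * (-(π / 2)) < δ * (2 / π) * Real.arctan s :=
        mul_lt_mul_of_pos_left h2 (by positivity)
      calc -δ = δ * (2 / π) * (-(π / 2)) := by field_simp
        _ < _ := this
    · have : δ * (2 / π) * Real.arctan s < δ * (2 / π) * (π / 2) :=
        mul_lt_mul_of_pos_left h1 (by positivity)
      calc _ < δ * (2 / π) * (π / 2) := this
        _ = δ := by field_simp
  · positivity

/-- **Restricting an arc to a neighbourhood of its midpoint.**  An injective immersion
`γ : ℝ → N` can be replaced, inside any neighbourhood `W` of `γ 0`, by the injective immersion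
`γ ∘ σ` (`σ` a diffeomorphism of `ℝ` onto a short interval around `0`, `σ 0 = 0`): it has the
same midpoint, its image lies in `W` and in that of `γ`, its nonzero parameters go to nonzero
parameters, and its tangent at `0` is a nonzero multiple of that of `γ`. [folklore] -/
theorem exists_arc_subset_nhds {γ : ℝ → N} (hγs : ContMDiff 𝓘(ℝ, ℝ) J ∞ γ)
    (hγinj : Injective γ) (hγimm : ∀ t, Injective (mfderiv 𝓘(ℝ, ℝ) J γ t))
    {W : Set N} (hW : W ∈ 𝓝 (γ 0)) :
    ∃ σ : ℝ → ℝ, ContMDiff 𝓘(ℝ, ℝ) J ∞ (γ ∘ σ) ∧ Injective (γ ∘ σ) ∧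
      (∀ t, Injective (mfderiv 𝓘(ℝ, ℝ) J (γ ∘ σ) t)) ∧ σ 0 = 0 ∧ (∀ t, t ≠ 0 → σ t ≠ 0) ∧
      (∀ t, γ (σ t) ∈ W) ∧
      ∃ a : ℝ, a ≠ 0 ∧ mfderiv 𝓘(ℝ, ℝ) J (γ ∘ σ) 0 (1 : ℝ) = a • mfderiv 𝓘(ℝ, ℝ) J γ 0 (1 : ℝ) := by
  -- a short parameter interval mapped into `W`
  have hγc : Continuous γ := hγs.continuous
  obtain ⟨δ, hδ, hball⟩ : ∃ δ > 0, ∀ r : ℝ, |r| < δ → γ r ∈ W := by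
    have : γ ⁻¹' W ∈ 𝓝 (0 : ℝ) := hγc.continuousAt.preimage_mem_nhds hW
    obtain ⟨δ, hδ, h⟩ := Metric.eventually_nhds_iff.1 this
    exact ⟨δ, hδ, fun r hr ↦ h (by rwa [Real.dist_0_eq_abs])⟩
  obtain ⟨σ, hσs, hσinj, hσ0, hσδ, σ', hσ', hσ'0⟩ := arctan_reparam' hδ
  have hσm : ContMDiff 𝓘(ℝ, ℝ) 𝓘(ℝ, ℝ) ∞ σ := hσs.contMDiff
  have hcomp : ContMDiff 𝓘(ℝ, ℝ) J ∞ (γ ∘ σ) := hγs.comp hσm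
  -- the differential of `σ`
  have hσmf : ∀ t, mfderiv 𝓘(ℝ, ℝ) 𝓘(ℝ, ℝ) σ t =
      ContinuousLinearMap.smulRight (1 : ℝ →L[ℝ] ℝ) (σ' t) := fun t ↦ by
    rw [mfderiv_eq_fderiv]
    exact (hσ' t).hasFDerivAt.fderiv
  have hchain : ∀ t, mfderiv 𝓘(ℝ, ℝ) J (γ ∘ σ) t =
      (mfderiv 𝓘(ℝ, ℝ) J γ (σ t)).comp (mfderiv 𝓘(ℝ, ℝ) 𝓘(ℝ, ℝ) σ t) := fun t ↦
    mfderiv_comp t ((hγs _).mdifferentiableAt (by simp)) ((hσm t).mdifferentiableAt (by simp))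
  refine ⟨σ, hcomp, hγinj.comp hσinj, fun t ↦ ?_, hσ0, fun t ht h ↦ ht (hσinj (h.trans hσ0.symm)),
    fun t ↦ hball _ (hσδ t), σ' 0, hσ'0 0, ?_⟩
  · rw [hchain t]
    have hσi : Injective (mfderiv 𝓘(ℝ, ℝ) 𝓘(ℝ, ℝ) σ t) := by
      rw [hσmf t]
      intro (a : ℝ) (b : ℝ) hab
      have hab' : a • σ' t = b • σ' t := hab
      exact smul_left_injective ℝ (hσ'0 t) hab'
    have key : Injective (⇑(mfderiv 𝓘(ℝ, ℝ) J γ (σ t)) ∘ ⇑(mfderiv 𝓘(ℝ, ℝ) 𝓘(ℝ, ℝ) σ t)) :=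
      (hγimm _).comp hσi
    exact key
  · have h1 := hchain 0
    rw [hσmf 0, hσ0] at h1
    rw [h1]
    show (mfderiv 𝓘(ℝ, ℝ) J γ 0) (((1 : ℝ →L[ℝ] ℝ) (1 : ℝ)) • σ' 0) =
      σ' 0 • (mfderiv 𝓘(ℝ, ℝ) J γ 0) (1 : ℝ)
    have e1 : ((1 : ℝ →L[ℝ] ℝ) (1 : ℝ)) • σ' 0 = σ' 0 • (1 : ℝ) := by simp
    rw [e1]
    exact (mfderiv 𝓘(ℝ, ℝ) J γ 0).map_smul (σ' 0) (1 : ℝ)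

/-- **Normal arcs inside a prescribed neighbourhood.**  In the situation of
`exists_normalArc_of_isSmoothEmbedding` (a `C^∞` embedding `f : M → N` of a compact manifold
into a Hausdorff manifold of larger dimension, boundaryless finite-dimensional real models), for
every `x₀ ∈ M` and every neighbourhood `W` of `f x₀` there is a normal arc `γ : ℝ → N` through
`γ 0 = f x₀` **with image in `W`**: a `C^∞` injective immersion meeting `f(M)` only at `s = 0`,
transversally (`dγ₀(1) ∉ df_{x₀}(T_{x₀}M)`). [folklore] -/
theorem exists_normalArc_subset
    [FiniteDimensional ℝ E] [FiniteDimensional ℝ E'] [I.Boundaryless] [J.Boundaryless]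
    [CompactSpace M] [T2Space N]
    {f : M → N} (hf : Manifold.IsSmoothEmbedding I J ∞ f)
    (hdim : finrank ℝ E < finrank ℝ E') (x₀ : M) {W : Set N} (hW : W ∈ 𝓝 (f x₀)) :
    ∃ γ : ℝ → N, ContMDiff 𝓘(ℝ, ℝ) J ∞ γ ∧ Injective γ ∧
      (∀ s, Injective (mfderiv 𝓘(ℝ, ℝ) J γ s)) ∧ γ 0 = f x₀ ∧ (∀ s, s ≠ 0 → γ s ∉ range f) ∧
      (mfderiv 𝓘(ℝ, ℝ) J γ 0 (1 : ℝ) : E') ∉ (mfderiv I J f x₀).range ∧ ∀ s, γ s ∈ W := by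
  obtain ⟨γ, hγs, hγinj, hγimm, hγ0, hγoff, hγtr⟩ := exists_normalArc_of_isSmoothEmbedding hf hdim x₀
  rw [← hγ0] at hW
  obtain ⟨σ, hs, hinj, himm, hσ0, hσne, hσW, a, ha, hda⟩ :=
    exists_arc_subset_nhds hγs hγinj hγimm hW
  refine ⟨γ ∘ σ, hs, hinj, himm, by rw [comp_apply, hσ0, hγ0], fun s hs' ↦ hγoff _ (hσne s hs'),
    ?_, fun s ↦ hσW s⟩
  rw [hda]
  intro hmem
  exact hγtr (((mfderiv I J f x₀).range.smul_mem_iff ha).1 hmem)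

/-! ### Closing an arc through a connected open set (arbitrary boundaryless model) -/

/-- **Closing an arc to an embedded circle, arbitrary boundaryless model.**  Let `N` be a
compact Hausdorff second countable `C^∞` manifold over a boundaryless model on a real vector
space of dimension `m ≥ 3`, `O ⊆ N` a connected open set and `γ : ℝ → N` a `C^∞` injective
immersion with `γ t ∈ O` for all `t ≠ 0`.  Then there is a smoothly embedded circle
`e : S¹ → N` through `e s₀ = γ 0`, with `e s ∈ O` for `s ≠ s₀`, and equal to `γ [-1, 1]` near
`γ 0`.  Proof: re-chart `N` on `ℝᵐ` (`Literature.Geometry.Manifold.Rechart`), push `γ` and `O`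
forward along the identity `into : N → Rechart` (the push-forward of `O` is open and connected,
hence path connected), close up by the tree's
`Milnor1965_exists_embedding_circle_through_arc_holds` (Milnor 1965, proof of Lemma 8.3 with
Whitney's Lemma 6.12), and pull the circle back along `out`.
[cite: MilnorHCobordism1965, proof of Lemma 8.3 (PDF p. 56)] -/
theorem exists_circle_through_arc {m : ℕ} (hm : 3 ≤ m)
    [FiniteDimensional ℝ E'] [J.Boundaryless]
    [T2Space N] [SecondCountableTopology N] [CompactSpace N] [IsManifold J ∞ N]
    (hE' : finrank ℝ E' = m) {O : Set N} (hO : IsOpen O) (hOc : IsConnected O)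
    (γ : ℝ → N) (hγs : ContMDiff 𝓘(ℝ, ℝ) J ∞ γ) (hγinj : Injective γ)
    (hγimm : ∀ t, Injective (mfderiv 𝓘(ℝ, ℝ) J γ t)) (hγO : ∀ t, t ≠ 0 → γ t ∈ O) :
    ∃ e : Metric.sphere (0 : EuclideanSpace ℝ (Fin 2)) 1 → N,
      Manifold.IsSmoothEmbedding (𝓡 1) J ∞ e ∧
      ∃ s₀, e s₀ = γ 0 ∧ (∀ s, s ≠ s₀ → e s ∈ O) ∧
      ∃ U ∈ 𝓝 (γ 0), range e ∩ U = γ '' Icc (-1) 1 ∩ U := by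
  -- ### re-charting `N` on `ℝᵐ`
  set Λ : E' ≃L[ℝ] EuclideanSpace ℝ (Fin m) :=
    ContinuousLinearEquiv.ofFinrankEq (by rw [hE', finrank_euclideanSpace_fin]) with hΛ
  set φ : G ≃ₜ EuclideanSpace ℝ (Fin m) := J.toHomeomorph.trans Λ.toHomeomorph with hφ
  have hφJ : ∀ x, φ x = Λ (J x) := fun x ↦ rfl
  have hφs : ContMDiff J (𝓡 m) ∞ φ := Rechart.contMDiff_of_apply_eq_linear φ Λ hφJ
  have hφs' : ContMDiff (𝓡 m) J ∞ φ.symm := Rechart.contMDiff_symm_of_apply_eq_linear φ Λ hφJ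
  haveI : IsManifold (𝓡 m) ∞ (Rechart φ N) := Rechart.isManifold φ N hφs hφs'
  haveI : SecondCountableTopology (Rechart φ N) := ‹SecondCountableTopology N›
  set ι : N → Rechart φ N := Rechart.into φ N with hι
  set ρ : Rechart φ N → N := Rechart.out φ N with hπ
  have hιs : ContMDiff J (𝓡 m) ∞ ι := Rechart.contMDiff_into φ N hφs hφs'
  have hπs : ContMDiff (𝓡 m) J ∞ ρ := Rechart.contMDiff_out φ N hφs hφs'
  have hπι : ∀ x, ρ (ι x) = x := fun x ↦ rfl
  have hιρ : ∀ y, ι (ρ y) = y := fun y ↦ rfl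
  -- differentials of the identity maps are injective
  have hdι : ∀ x, Injective (mfderiv J (𝓡 m) ι x) := fun x ↦ by
    have h1 : mfderiv J J (ρ ∘ ι) x = (mfderiv (𝓡 m) J ρ (ι x)).comp (mfderiv J (𝓡 m) ι x) :=
      mfderiv_comp x (hπs.mdifferentiableAt (by simp)) (hιs.mdifferentiableAt (by simp))
    have h2 : mfderiv J J (ρ ∘ ι) x = ContinuousLinearMap.id ℝ (TangentSpace J x) := by
      have : ρ ∘ ι = id := funext hπι
      rw [this, mfderiv_id]
    have key : Injective (⇑(mfderiv (𝓡 m) J ρ (ι x)) ∘ ⇑(mfderiv J (𝓡 m) ι x)) := by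
      have h3 : Injective (mfderiv J J (ρ ∘ ι) x) := by
        rw [h2]; exact injective_id
      rw [h1] at h3
      exact h3
    exact key.of_comp
  have hdπ : ∀ y, Injective (mfderiv (𝓡 m) J ρ y) := fun y ↦ by
    have h1 : mfderiv (𝓡 m) (𝓡 m) (ι ∘ ρ) y =
        (mfderiv J (𝓡 m) ι (ρ y)).comp (mfderiv (𝓡 m) J ρ y) :=
      mfderiv_comp y (hιs.mdifferentiableAt (by simp)) (hπs.mdifferentiableAt (by simp))
    have h2 : mfderiv (𝓡 m) (𝓡 m) (ι ∘ ρ) y =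
        ContinuousLinearMap.id ℝ (TangentSpace (𝓡 m) y) := by
      have : ι ∘ ρ = id := funext hιρ
      rw [this, mfderiv_id]
    have key : Injective (⇑(mfderiv J (𝓡 m) ι (ρ y)) ∘ ⇑(mfderiv (𝓡 m) J ρ y)) := by
      have h3 : Injective (mfderiv (𝓡 m) (𝓡 m) (ι ∘ ρ) y) := by
        rw [h2]; exact injective_id
      rw [h1] at h3
      exact h3
    exact key.of_comp
  -- ### the arc and the open set pushed forward
  set γ' : ℝ → Rechart φ N := ι ∘ γ with hγ'
  have hγ's : ContMDiff 𝓘(ℝ, ℝ) (𝓡 m) ∞ γ' := hιs.comp hγs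
  have hγ'inj : Injective γ' := fun s t h ↦ hγinj h
  have hγ'imm : ∀ s, Injective (mfderiv 𝓘(ℝ, ℝ) (𝓡 m) γ' s) := fun s ↦ by
    have h1 : mfderiv 𝓘(ℝ, ℝ) (𝓡 m) γ' s =
        (mfderiv J (𝓡 m) ι (γ s)).comp (mfderiv 𝓘(ℝ, ℝ) J γ s) :=
      mfderiv_comp s (hιs.mdifferentiableAt (by simp)) ((hγs s).mdifferentiableAt (by simp))
    rw [h1]
    have key : Injective (⇑(mfderiv J (𝓡 m) ι (γ s)) ∘ ⇑(mfderiv 𝓘(ℝ, ℝ) J γ s)) :=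
      (hdι _).comp (hγimm s)
    exact key
  set O' : Set (Rechart φ N) := ι '' O with hO'
  have hO'eq : O' = ρ ⁻¹' O := by
    ext y
    constructor
    · rintro ⟨z, hz, rfl⟩
      exact hz
    · intro hy
      exact ⟨ρ y, hy, rfl⟩
  have hγ'O : ∀ s, s ≠ 0 → γ' s ∈ O' := fun s hs ↦ ⟨γ s, hγO s hs, rfl⟩
  have hO'open : IsOpen O' := by
    rw [hO'eq]
    exact hO.preimage hπs.continuous
  haveI : LocallyPathConnectedSpace (Rechart φ N) :=
    ChartedSpace.locallyPathConnectedSpace (EuclideanSpace ℝ (Fin m)) (Rechart φ N)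
  have hO'pc : IsPathConnected O' :=
    hO'open.isConnected_iff_isPathConnected.1 (hOc.image ι hιs.continuous.continuousOn)
  -- ### closing up in the re-charted manifold and pulling back
  obtain ⟨e', he', s₀, hs₀, he'O, U', hU', hUeq'⟩ :=
    Milnor1965_exists_embedding_circle_through_arc_holds hm hO'open hO'pc γ' hγ's hγ'inj hγ'imm
      hγ'O
  set e : Metric.sphere (0 : EuclideanSpace ℝ (Fin 2)) 1 → N := ρ ∘ e' with he
  have hes : ContMDiff (𝓡 1) J ∞ e := hπs.comp he'.contMDiff
  have heinj : Injective e := fun s t h ↦ he'.isEmbedding.injective h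
  have heimm : ∀ s, Injective (mfderiv (𝓡 1) J e s) := fun s ↦ by
    have h1 : mfderiv (𝓡 1) J e s =
        (mfderiv (𝓡 m) J ρ (e' s)).comp (mfderiv (𝓡 1) (𝓡 m) e' s) :=
      mfderiv_comp s (hπs.mdifferentiableAt (by simp))
        (he'.contMDiff.mdifferentiableAt (by simp))
    rw [h1]
    have key : Injective (⇑(mfderiv (𝓡 m) J ρ (e' s)) ∘ ⇑(mfderiv (𝓡 1) (𝓡 m) e' s)) :=
      (hdπ _).comp (mfderiv_injective_of_isImmersion he'.isImmersion (by simp) s)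
    exact key
  have hemb : Manifold.IsSmoothEmbedding (𝓡 1) J ∞ e :=
    isSmoothEmbedding_of_injective_of_injective_mfderiv hes (by simp) heinj heimm
  refine ⟨e, hemb, s₀, ?_, fun s hs ↦ ?_, ρ '' U', ?_, ?_⟩
  · -- `e s₀ = γ 0`
    change ρ (e' s₀) = γ 0
    rw [hs₀]
    rfl
  · -- `e s ∈ O` for `s ≠ s₀`
    have := he'O s hs
    rw [hO'eq] at this
    exact this
  · -- the neighbourhood
    have : ρ '' U' = ι ⁻¹' U' := by
      ext y
      constructor
      · rintro ⟨z, hz, rfl⟩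
        exact hz
      · intro hy
        exact ⟨ι y, hy, rfl⟩
    rw [this]
    exact hιs.continuous.continuousAt.preimage_mem_nhds hU'
  · -- `range e ∩ U = γ [-1, 1] ∩ U`
    have h1 := congrArg (image ρ) hUeq'
    have hinjπ : Injective ρ := fun a b h ↦ h
    rw [image_inter hinjπ, image_inter hinjπ, ← range_comp, ← image_comp] at h1
    exact h1

/-! ### Dual circles -/

/-- **Dual circles to a compact embedded submanifold of codimension `≥ 1` with connected
complement, arbitrary boundaryless model.**  Let `N` be a compact Hausdorff second countable
`C^∞` manifold over a boundaryless model on a real vector space of dimension `m ≥ 3`, and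
`f : M → N` a `C^∞` embedding of a compact manifold of smaller dimension with connected
complement `N ∖ f(M)`.  Through every point `f x₀` there is a smoothly embedded circle
`e : S¹ → N` meeting `f(M)` exactly in `e s₀ = f x₀` and equal near `f x₀` to a normal arc `γ`
of `f(M)` (`exists_normalArc_of_isSmoothEmbedding`: an injective immersion with `γ 0 = f x₀`,
`γ s ∉ f(M)` for `s ≠ 0`, `γ'(0) ∉ df_{x₀}(T_{x₀}M)`), by `exists_circle_through_arc` applied to
the normal arc and the complement of `f(M)`. [cite: MilnorHCobordism1965, proof of Lemma 8.3 (PDF p. 56)] -/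
theorem EmbeddedSubmanifold.exists_dualCircle {m : ℕ} (hm : 3 ≤ m)
    [FiniteDimensional ℝ E] [FiniteDimensional ℝ E'] [I.Boundaryless] [J.Boundaryless]
    [CompactSpace M] [T2Space N] [SecondCountableTopology N] [CompactSpace N] [IsManifold J ∞ N]
    (hE' : finrank ℝ E' = m) {f : M → N} (hf : Manifold.IsSmoothEmbedding I J ∞ f)
    (hdim : finrank ℝ E < m) (hconn : IsConnected (range f)ᶜ) (x₀ : M) :
    ∃ e : Metric.sphere (0 : EuclideanSpace ℝ (Fin 2)) 1 → N,
      Manifold.IsSmoothEmbedding (𝓡 1) J ∞ e ∧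
      ∃ s₀, e s₀ = f x₀ ∧ (∀ s, s ≠ s₀ → e s ∉ range f) ∧
      ∃ γ : ℝ → N, ContMDiff 𝓘(ℝ, ℝ) J ∞ γ ∧ Injective γ ∧
        (∀ s, Injective (mfderiv 𝓘(ℝ, ℝ) J γ s)) ∧ γ 0 = f x₀ ∧
        (∀ s, s ≠ 0 → γ s ∉ range f) ∧
        (mfderiv 𝓘(ℝ, ℝ) J γ 0 (1 : ℝ) : E') ∉ (mfderiv I J f x₀).range ∧
        ∃ U ∈ 𝓝 (f x₀), range e ∩ U = γ '' Icc (-1) 1 ∩ U := by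
  obtain ⟨γ, hγs, hγinj, hγimm, hγ0, hγoff, hγtr⟩ :=
    exists_normalArc_of_isSmoothEmbedding hf (by omega) x₀
  have hO : IsOpen (range f)ᶜ :=
    (isCompact_range hf.contMDiff.continuous).isClosed.isOpen_compl
  obtain ⟨e, he, s₀, hs₀, heO, U, hU, hUeq⟩ :=
    exists_circle_through_arc hm hE' hO hconn γ hγs hγinj hγimm hγoff
  refine ⟨e, he, s₀, hs₀.trans hγ0, fun s hs ↦ heO s hs, γ, hγs, hγinj, hγimm, hγ0, hγoff, hγtr,
    U, ?_, hUeq⟩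
  rwa [hγ0] at hU

end General

/-! ### The dual circle of a non-separating `n`-sphere in `S¹ × Sⁿ` -/

namespace BudneyGabai2019_thm_3_13

/-- **The dual circle of a non-separating sphere** (Budney–Gabai 2019, proof of Thm. 3.13, first
step, p. 22: *"complementary to a non-separating sphere there is an embedding `S¹ → S¹ × Sⁿ`
that intersects the sphere precisely once and transversely"*).  For a smoothly embedded
`n`-sphere `e : Sⁿ → S¹ × Sⁿ`, `n ≥ 2`, whose image has connected complement, and any
`x₀ ∈ Sⁿ`, there is a smoothly embedded circle `c : S¹ → S¹ × Sⁿ` which meets `e(Sⁿ)` exactly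
in the point `c s₀ = e x₀` and coincides near that point with a normal arc `γ` of the sphere
(`γ 0 = e x₀`, `γ s ∉ e(Sⁿ)` for `s ≠ 0`, `γ'(0) ∉ de_{x₀}(T_{x₀}Sⁿ)`): it crosses the sphere
once, transversally (`EmbeddedSubmanifold.exists_dualCircle` for the product model
`(𝓡 1).prod (𝓡 n)` of `S¹ × Sⁿ`, of dimension `n + 1 ≥ 3`).
[cite: BudneyGabai2019, proof of Thm. 3.13 (arXiv:1912.09029 v2, p. 22)] -/
theorem exists_dualCircle {n : ℕ} (hn : 2 ≤ n)
    {e : Metric.sphere (0 : EuclideanSpace ℝ (Fin (n + 1))) 1 →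
      Circle × Metric.sphere (0 : EuclideanSpace ℝ (Fin (n + 1))) 1}
    (he : Manifold.IsSmoothEmbedding (𝓡 n) ((𝓡 1).prod (𝓡 n)) ∞ e)
    (hconn : IsConnected (range e)ᶜ) (x₀ : Metric.sphere (0 : EuclideanSpace ℝ (Fin (n + 1))) 1) :
    ∃ c : Metric.sphere (0 : EuclideanSpace ℝ (Fin 2)) 1 →
        Circle × Metric.sphere (0 : EuclideanSpace ℝ (Fin (n + 1))) 1,
      Manifold.IsSmoothEmbedding (𝓡 1) ((𝓡 1).prod (𝓡 n)) ∞ c ∧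
      ∃ s₀, c s₀ = e x₀ ∧ (∀ s, s ≠ s₀ → c s ∉ range e) ∧
      ∃ γ : ℝ → Circle × Metric.sphere (0 : EuclideanSpace ℝ (Fin (n + 1))) 1,
        ContMDiff 𝓘(ℝ, ℝ) ((𝓡 1).prod (𝓡 n)) ∞ γ ∧ Injective γ ∧
        (∀ s, Injective (mfderiv 𝓘(ℝ, ℝ) ((𝓡 1).prod (𝓡 n)) γ s)) ∧ γ 0 = e x₀ ∧
        (∀ s, s ≠ 0 → γ s ∉ range e) ∧
        (mfderiv 𝓘(ℝ, ℝ) ((𝓡 1).prod (𝓡 n)) γ 0 (1 : ℝ) :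
            EuclideanSpace ℝ (Fin 1) × EuclideanSpace ℝ (Fin n)) ∉
          (mfderiv (𝓡 n) ((𝓡 1).prod (𝓡 n)) e x₀).range ∧
        ∃ U ∈ 𝓝 (e x₀), range c ∩ U = γ '' Icc (-1) 1 ∩ U :=
  EmbeddedSubmanifold.exists_dualCircle (m := n + 1) (by omega)
    (by rw [finrank_prod, finrank_euclideanSpace_fin, finrank_euclideanSpace_fin]; omega) he
    (by rw [finrank_euclideanSpace_fin]; omega) hconn x₀

end BudneyGabai2019_thm_3_13

end Literature.Topology.FourManifolds

end
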